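import Mathlib
import Summits.Ventures.PercRepro2.StarOXhatB
import Summits.Ventures.PercRepro2.StarBXhatA
import Summits.Ventures.PercRepro2.HMFPendantO
import Summits.Ventures.PercRepro2.StarHStar
import Summits.Ventures.PercRepro2.StarHXhatA

/-!
# The mean field `X̂` at the four-coin hub star `{a₁, a₂, o, b}`: the row sums, part B (blind cell
PercRepro2, night-1 g11; NIGHT1-G11.md §5; g11's StarHXhat.lean split in two by night-1 g12 under the
400-line lint — this file l.274–601 of the twin: the all-closed row (`sum_cccc_rows`), the `β`-only
and `α`-only rows (`sum_f2_rows₄`, `sum_f1_rows₄`) and the assembly `Xhat_star_h`)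
-/

namespace Summit.Ventures.PercRepro2

open StarGlue PendantRoot

namespace StarH

section Xhat

variable {V : Type*} {E : Type*} [Fintype E] [DecidableEq E] [Fintype V] [DecidableEq V]
  {R : Type*} [Field R] [LinearOrder R] [IsStrictOrderedRing R]

variable (p : E → R) (ends : E → Sym2 V) {f₁ f₂ f₃ f₄ : E} {a₃ a₁ a₂ o b : V}

open StarO (pOut viaStar cw prob_viaStar free_viaStar heavySum lightSum)
open StarB (cl_conn_iff cl_inter_conn_eq_del_outc termW_of_b_left termW_of_b_right termW_of_b_none
  termW_of_both)

section Closed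

omit [Fintype E] [DecidableEq E] [LinearOrder R] [IsStrictOrderedRing R] in
/-- With every coin closed the cluster of `a₃` is `{a₃}`. -/
lemma clusterEvent_a3_inter_outc_cccc (hf₁ : ends f₁ = s(a₃, a₁)) (hf₂ : ends f₂ = s(a₃, a₂))
    (hf₃ : ends f₃ = s(a₃, o)) (hf₄ : ends f₄ = s(a₃, b))
    (hstar : ∀ e, a₃ ∈ ends e → e = f₁ ∨ e = f₂ ∨ e = f₃ ∨ e = f₄)
    (h31 : a₃ ≠ a₁) (h32 : a₃ ≠ a₂) (h3o : a₃ ≠ o) (h3b : a₃ ≠ b) (W : Finset V) :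
    clusterEvent ends a₃ (↑W : Set V) ∩ outc₄ f₁ f₂ f₃ f₄ false false false false =
      if W = {a₃} then outc₄ f₁ f₂ f₃ f₄ false false false false else ∅ := by
  have hcl : ∀ ω : Config E, ω f₁ = false → ω f₂ = false → ω f₃ = false → ω f₄ = false →
      cluster ends ω a₃ = {a₃} := by
    intro ω h1 h2 h3 h4
    ext y
    simp only [mem_cluster, Set.mem_singleton_iff]
    constructor
    · intro h
      by_contra hy
      rw [conn_a3_iff₄ hf₁ hf₂ hf₃ hf₄ hstar h31 h32 h3o h3b hy] at h
      simp [touch, h1, h2, h3, h4] at h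
    · rintro rfl; exact conn_refl _ _ _
  ext ω
  split_ifs with hW
  · subst hW
    simp only [Set.mem_inter_iff, mem_clusterEvent, mem_outc₄, Finset.coe_singleton,
      and_iff_right_iff_imp]
    rintro ⟨h1, h2, h3, h4⟩
    exact hcl ω h1 h2 h3 h4
  · simp only [Set.mem_inter_iff, mem_clusterEvent, mem_outc₄, Set.mem_empty_iff_false, iff_false,
      not_and]
    intro h h1 h2 h3 h4
    apply hW
    rw [hcl ω h1 h2 h3 h4] at h
    exact Finset.coe_injective (by rw [Finset.coe_singleton]; exact h.symm)

omit [LinearOrder R] [IsStrictOrderedRing R] in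
/-- The all-closed row is the isolated term. -/
lemma sum_cccc_rows (hf₁ : ends f₁ = s(a₃, a₁)) (hf₂ : ends f₂ = s(a₃, a₂))
    (hf₃ : ends f₃ = s(a₃, o)) (hf₄ : ends f₄ = s(a₃, b))
    (hstar : ∀ e, a₃ ∈ ends e → e = f₁ ∨ e = f₂ ∨ e = f₃ ∨ e = f₄)
    (h31 : a₃ ≠ a₁) (h32 : a₃ ≠ a₂) (h3o : a₃ ≠ o) (h3b : a₃ ≠ b) (h12 : f₁ ≠ f₂) (h13 : f₁ ≠ f₃)
    (h14 : f₁ ≠ f₄) (h23 : f₂ ≠ f₃) (h24 : f₂ ≠ f₄) (h34 : f₃ ≠ f₄) :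
    ∑ W : Finset V, prob p (clusterEvent ends a₃ (↑W : Set V) ∩ outc₄ f₁ f₂ f₃ f₄ false false false false) *
        termW p ends o a₁ a₂ b W =
      (1 - p f₁) * (1 - p f₂) * (1 - p f₃) * (1 - p f₄) * termW p ends o a₁ a₂ b {a₃} := by
  have hw : prob p (outc₄ f₁ f₂ f₃ f₄ false false false false) =
      (1 - p f₁) * (1 - p f₂) * (1 - p f₃) * (1 - p f₄) := by
    have := prob_inter_outc₄ p h12 h13 h14 h23 h24 h34 (A := Set.univ) (fun _ _ _ => rfl)
      (fun _ _ _ => rfl) (fun _ _ _ => rfl) (fun _ _ _ => rfl) false false false false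
    rwa [Set.univ_inter, prob_univ, one_mul] at this
  simp only [clusterEvent_a3_inter_outc_cccc ends hf₁ hf₂ hf₃ hf₄ hstar h31 h32 h3o h3b]
  rw [Finset.sum_eq_single ({a₃} : Finset V)]
  · rw [if_pos rfl, hw]
  · intro W _ hW
    rw [if_neg hW, prob_empty, zero_mul]
  · intro h; exact absurd (Finset.mem_univ _) h

omit [Fintype E] [DecidableEq E] [LinearOrder R] [IsStrictOrderedRing R] in
/-- With only `β` open the cluster of `a₃` is `a₃` together with the star-closed cluster of `a₂`. -/
lemma clusterEvent_a3_inter_outc_f2₄ (hf₁ : ends f₁ = s(a₃, a₁)) (hf₂ : ends f₂ = s(a₃, a₂))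
    (hf₃ : ends f₃ = s(a₃, o)) (hf₄ : ends f₄ = s(a₃, b))
    (hstar : ∀ e, a₃ ∈ ends e → e = f₁ ∨ e = f₂ ∨ e = f₃ ∨ e = f₄)
    (h31 : a₃ ≠ a₁) (h32 : a₃ ≠ a₂) (h3o : a₃ ≠ o) (h3b : a₃ ≠ b) (W : Finset V) :
    clusterEvent ends a₃ (↑W : Set V) ∩ outc₄ f₁ f₂ f₃ f₄ false true false false =
      if a₃ ∈ W then
        viaStar ends a₃ (clusterEvent ends a₂ (↑(W.erase a₃) : Set V)) ∩
          outc₄ f₁ f₂ f₃ f₄ false true false false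
      else ∅ := by
  have hcl : ∀ ω : Config E, ω f₁ = false → ω f₂ = true → ω f₃ = false → ω f₄ = false →
      cluster ends ω a₃ = insert a₃ (cluster ends (closeStar ends a₃ ω) a₂) := by
    intro ω h1 h2 h3 h4
    ext y
    simp only [mem_cluster, Set.mem_insert_iff]
    by_cases hy : y = a₃
    · subst hy; simp [conn_refl]
    · rw [conn_a3_iff₄ hf₁ hf₂ hf₃ hf₄ hstar h31 h32 h3o h3b hy]
      simp only [touch, h1, h2, h3, h4, Bool.false_eq_true, false_and, false_or, or_false, true_and,
        conn_comm (ends := ends) (closeStar ends a₃ ω) y a₂]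
      exact ⟨Or.inr, fun h => h.resolve_left hy⟩
  have hnot : ∀ ω : Config E, a₃ ∉ cluster ends (closeStar ends a₃ ω) a₂ := fun ω h =>
    not_conn_closeStar h32.symm h
  ext ω
  split_ifs with hW
  · simp only [Set.mem_inter_iff, mem_clusterEvent, mem_outc₄, viaStar, Set.mem_setOf_eq,
      and_congr_left_iff]
    rintro ⟨h1, h2, h3, h4⟩
    rw [hcl ω h1 h2 h3 h4]
    constructor
    · intro h
      ext y
      simp only [Finset.coe_erase, Set.mem_sdiff, Set.mem_singleton_iff]
      constructor
      · intro hy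
        refine ⟨?_, fun hy3 => hnot ω (hy3 ▸ hy)⟩
        rw [← h]; exact Set.mem_insert_of_mem _ hy
      · rintro ⟨hy, hy3⟩
        rw [← h] at hy
        exact (Set.mem_insert_iff.1 hy).resolve_left hy3
    · intro h
      rw [h, Finset.coe_erase, Set.insert_sdiff_singleton, Set.insert_eq_of_mem (Finset.mem_coe.2 hW)]
  · simp only [Set.mem_inter_iff, mem_clusterEvent, mem_outc₄, Set.mem_empty_iff_false, iff_false,
      not_and]
    intro h h1 h2 h3 h4
    apply hW
    rw [hcl ω h1 h2 h3 h4] at h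
    rw [← Finset.mem_coe, ← h]
    exact Set.mem_insert _ _

omit [Fintype E] [DecidableEq E] [LinearOrder R] [IsStrictOrderedRing R] in
/-- With only `α` open the cluster of `a₃` is `a₃` together with the star-closed cluster of `a₁`. -/
lemma clusterEvent_a3_inter_outc_f1₄ (hf₁ : ends f₁ = s(a₃, a₁)) (hf₂ : ends f₂ = s(a₃, a₂))
    (hf₃ : ends f₃ = s(a₃, o)) (hf₄ : ends f₄ = s(a₃, b))
    (hstar : ∀ e, a₃ ∈ ends e → e = f₁ ∨ e = f₂ ∨ e = f₃ ∨ e = f₄)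
    (h31 : a₃ ≠ a₁) (h32 : a₃ ≠ a₂) (h3o : a₃ ≠ o) (h3b : a₃ ≠ b) (W : Finset V) :
    clusterEvent ends a₃ (↑W : Set V) ∩ outc₄ f₁ f₂ f₃ f₄ true false false false =
      if a₃ ∈ W then
        viaStar ends a₃ (clusterEvent ends a₁ (↑(W.erase a₃) : Set V)) ∩
          outc₄ f₁ f₂ f₃ f₄ true false false false
      else ∅ := by
  have hcl : ∀ ω : Config E, ω f₁ = true → ω f₂ = false → ω f₃ = false → ω f₄ = false →
      cluster ends ω a₃ = insert a₃ (cluster ends (closeStar ends a₃ ω) a₁) := by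
    intro ω h1 h2 h3 h4
    ext y
    simp only [mem_cluster, Set.mem_insert_iff]
    by_cases hy : y = a₃
    · subst hy; simp [conn_refl]
    · rw [conn_a3_iff₄ hf₁ hf₂ hf₃ hf₄ hstar h31 h32 h3o h3b hy]
      simp only [touch, h1, h2, h3, h4, Bool.false_eq_true, false_and, or_false, true_and,
        conn_comm (ends := ends) (closeStar ends a₃ ω) y a₁]
      exact ⟨Or.inr, fun h => h.resolve_left hy⟩
  have hnot : ∀ ω : Config E, a₃ ∉ cluster ends (closeStar ends a₃ ω) a₁ := fun ω h =>
    not_conn_closeStar h31.symm h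
  ext ω
  split_ifs with hW
  · simp only [Set.mem_inter_iff, mem_clusterEvent, mem_outc₄, viaStar, Set.mem_setOf_eq,
      and_congr_left_iff]
    rintro ⟨h1, h2, h3, h4⟩
    rw [hcl ω h1 h2 h3 h4]
    constructor
    · intro h
      ext y
      simp only [Finset.coe_erase, Set.mem_sdiff, Set.mem_singleton_iff]
      constructor
      · intro hy
        refine ⟨?_, fun hy3 => hnot ω (hy3 ▸ hy)⟩
        rw [← h]; exact Set.mem_insert_of_mem _ hy
      · rintro ⟨hy, hy3⟩
        rw [← h] at hy
        exact (Set.mem_insert_iff.1 hy).resolve_left hy3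
    · intro h
      rw [h, Finset.coe_erase, Set.insert_sdiff_singleton, Set.insert_eq_of_mem (Finset.mem_coe.2 hW)]
  · simp only [Set.mem_inter_iff, mem_clusterEvent, mem_outc₄, Set.mem_empty_iff_false, iff_false,
      not_and]
    intro h h1 h2 h3 h4
    apply hW
    rw [hcl ω h1 h2 h3 h4] at h
    rw [← Finset.mem_coe, ← h]
    exact Set.mem_insert _ _

end Closed

omit [LinearOrder R] [IsStrictOrderedRing R] in
/-- The `β`-only rows of `X̂`: reindexed by `W ↦ W.erase a₃`, they are the heavy row sum at the
star-zeroed weights. -/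
lemma sum_f2_rows₄ (hf₁ : ends f₁ = s(a₃, a₁)) (hf₂ : ends f₂ = s(a₃, a₂))
    (hf₃ : ends f₃ = s(a₃, o)) (hf₄ : ends f₄ = s(a₃, b))
    (hstar : ∀ e, a₃ ∈ ends e → e = f₁ ∨ e = f₂ ∨ e = f₃ ∨ e = f₄)
    (h31 : a₃ ≠ a₁) (h32 : a₃ ≠ a₂) (h3o : a₃ ≠ o) (h3b : a₃ ≠ b) (h12 : f₁ ≠ f₂) (h13 : f₁ ≠ f₃)
    (h14 : f₁ ≠ f₄) (h23 : f₂ ≠ f₃) (h24 : f₂ ≠ f₄) (h34 : f₃ ≠ f₄) :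
    ∑ W : Finset V, prob p (clusterEvent ends a₃ (↑W : Set V) ∩ outc₄ f₁ f₂ f₃ f₄ false true false false) *
        termW p ends o a₁ a₂ b W =
      (1 - p f₁) * p f₂ * (1 - p f₃) * (1 - p f₄) * heavySum ends (pOut p ends a₃) o a₁ a₂ b := by
  have hf1 : a₃ ∈ ends f₁ := by rw [hf₁]; exact Sym2.mem_mk_left _ _
  have hf2 : a₃ ∈ ends f₂ := by rw [hf₂]; exact Sym2.mem_mk_left _ _
  have hf3 : a₃ ∈ ends f₃ := by rw [hf₃]; exact Sym2.mem_mk_left _ _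
  have hf4 : a₃ ∈ ends f₄ := by rw [hf₄]; exact Sym2.mem_mk_left _ _
  have fac : ∀ (A : Set (Config E)),
      prob p (viaStar ends a₃ A ∩ outc₄ f₁ f₂ f₃ f₄ false true false false) =
        prob (pOut p ends a₃) A * (1 - p f₁) * p f₂ * (1 - p f₃) * (1 - p f₄) := by
    intro A
    rw [prob_inter_outc₄ p h12 h13 h14 h23 h24 h34 (free_viaStar ends a₃ hf1 A)
      (free_viaStar ends a₃ hf2 A) (free_viaStar ends a₃ hf3 A) (free_viaStar ends a₃ hf4 A),
      prob_viaStar]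
    simp [cw]
  simp only [clusterEvent_a3_inter_outc_f2₄ ends hf₁ hf₂ hf₃ hf₄ hstar h31 h32 h3o h3b]
  rw [← StarO.sum_cluster_termW_eq_heavySum p ends, Finset.mul_sum]
  set F : Finset V → R := fun W => prob p (if a₃ ∈ W then
    viaStar ends a₃ (clusterEvent ends a₂ (↑(W.erase a₃) : Set V)) ∩
      outc₄ f₁ f₂ f₃ f₄ false true false false
    else ∅) * termW p ends o a₁ a₂ b W with hF
  set G : Finset V → R := fun W => (1 - p f₁) * p f₂ * (1 - p f₃) * (1 - p f₄) *
    (prob (pOut p ends a₃) (clusterEvent ends a₂ (↑W : Set V)) *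
      termW (pOut p ends a₃) ends o a₁ a₂ b W) with hG
  have hL := Finset.sum_filter_add_sum_filter_not Finset.univ (fun W : Finset V => a₃ ∈ W) F
  have hR := Finset.sum_filter_add_sum_filter_not Finset.univ (fun W : Finset V => a₃ ∈ W) G
  have hL0 : ∑ W ∈ Finset.univ.filter (fun W : Finset V => ¬ a₃ ∈ W), F W = 0 := by
    refine Finset.sum_eq_zero fun W hW => ?_
    simp only [hF, if_neg (Finset.mem_filter.1 hW).2, prob_empty, zero_mul]
  have hR0 : ∑ W ∈ Finset.univ.filter (fun W : Finset V => a₃ ∈ W), G W = 0 := by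
    refine Finset.sum_eq_zero fun W hW => ?_
    simp only [hG, StarO.prob_pOut_clusterEvent_of_mem p ends h32.symm (Finset.mem_filter.1 hW).2,
      zero_mul, mul_zero]
  show ∑ W, F W = ∑ W, G W
  rw [← hL, ← hR, hL0, hR0, add_zero, zero_add]
  refine Finset.sum_bij' (fun W _ => W.erase a₃) (fun W' _ => insert a₃ W') ?_ ?_ ?_ ?_ ?_
  · intro W hW
    simp only [Finset.mem_filter, Finset.mem_univ, true_and, Finset.mem_erase, ne_eq,
      not_true_eq_false, false_and, not_false_eq_true]
  · intro W' hW'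
    simp only [Finset.mem_filter, Finset.mem_univ, true_and, Finset.mem_insert, true_or]
  · intro W hW
    exact Finset.insert_erase (Finset.mem_filter.1 hW).2
  · intro W' hW'
    exact Finset.erase_insert (Finset.mem_filter.1 hW').2
  · intro W hW
    have h3W : a₃ ∈ W := (Finset.mem_filter.1 hW).2
    simp only [hF, hG, if_pos h3W, fac]
    have : W = insert a₃ (W.erase a₃) := (Finset.insert_erase h3W).symm
    conv_lhs => rw [this]
    rw [StarO.termW_insert_a3 p ends (W.erase a₃) h31 h32 h3o h3b, Finset.erase_insert
      (Finset.notMem_erase a₃ W)]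
    ring

omit [LinearOrder R] [IsStrictOrderedRing R] in
/-- The `α`-only rows of `X̂`: the light row sum at the star-zeroed weights. -/
lemma sum_f1_rows₄ (hf₁ : ends f₁ = s(a₃, a₁)) (hf₂ : ends f₂ = s(a₃, a₂))
    (hf₃ : ends f₃ = s(a₃, o)) (hf₄ : ends f₄ = s(a₃, b))
    (hstar : ∀ e, a₃ ∈ ends e → e = f₁ ∨ e = f₂ ∨ e = f₃ ∨ e = f₄)
    (h31 : a₃ ≠ a₁) (h32 : a₃ ≠ a₂) (h3o : a₃ ≠ o) (h3b : a₃ ≠ b) (h12 : f₁ ≠ f₂) (h13 : f₁ ≠ f₃)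
    (h14 : f₁ ≠ f₄) (h23 : f₂ ≠ f₃) (h24 : f₂ ≠ f₄) (h34 : f₃ ≠ f₄) :
    ∑ W : Finset V, prob p (clusterEvent ends a₃ (↑W : Set V) ∩ outc₄ f₁ f₂ f₃ f₄ true false false false) *
        termW p ends o a₁ a₂ b W =
      p f₁ * (1 - p f₂) * (1 - p f₃) * (1 - p f₄) * lightSum ends (pOut p ends a₃) o a₁ a₂ b := by
  have hf1 : a₃ ∈ ends f₁ := by rw [hf₁]; exact Sym2.mem_mk_left _ _
  have hf2 : a₃ ∈ ends f₂ := by rw [hf₂]; exact Sym2.mem_mk_left _ _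
  have hf3 : a₃ ∈ ends f₃ := by rw [hf₃]; exact Sym2.mem_mk_left _ _
  have hf4 : a₃ ∈ ends f₄ := by rw [hf₄]; exact Sym2.mem_mk_left _ _
  have fac : ∀ (A : Set (Config E)),
      prob p (viaStar ends a₃ A ∩ outc₄ f₁ f₂ f₃ f₄ true false false false) =
        prob (pOut p ends a₃) A * p f₁ * (1 - p f₂) * (1 - p f₃) * (1 - p f₄) := by
    intro A
    rw [prob_inter_outc₄ p h12 h13 h14 h23 h24 h34 (free_viaStar ends a₃ hf1 A)
      (free_viaStar ends a₃ hf2 A) (free_viaStar ends a₃ hf3 A) (free_viaStar ends a₃ hf4 A),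
      prob_viaStar]
    simp [cw]
  simp only [clusterEvent_a3_inter_outc_f1₄ ends hf₁ hf₂ hf₃ hf₄ hstar h31 h32 h3o h3b]
  rw [← StarO.sum_cluster_termW_eq_lightSum p ends, Finset.mul_sum]
  set F : Finset V → R := fun W => prob p (if a₃ ∈ W then
    viaStar ends a₃ (clusterEvent ends a₁ (↑(W.erase a₃) : Set V)) ∩
      outc₄ f₁ f₂ f₃ f₄ true false false false
    else ∅) * termW p ends o a₁ a₂ b W with hF
  set G : Finset V → R := fun W => p f₁ * (1 - p f₂) * (1 - p f₃) * (1 - p f₄) *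
    (prob (pOut p ends a₃) (clusterEvent ends a₁ (↑W : Set V)) *
      termW (pOut p ends a₃) ends o a₁ a₂ b W) with hG
  have hL := Finset.sum_filter_add_sum_filter_not Finset.univ (fun W : Finset V => a₃ ∈ W) F
  have hR := Finset.sum_filter_add_sum_filter_not Finset.univ (fun W : Finset V => a₃ ∈ W) G
  have hL0 : ∑ W ∈ Finset.univ.filter (fun W : Finset V => ¬ a₃ ∈ W), F W = 0 := by
    refine Finset.sum_eq_zero fun W hW => ?_
    simp only [hF, if_neg (Finset.mem_filter.1 hW).2, prob_empty, zero_mul]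
  have hR0 : ∑ W ∈ Finset.univ.filter (fun W : Finset V => a₃ ∈ W), G W = 0 := by
    refine Finset.sum_eq_zero fun W hW => ?_
    simp only [hG, StarO.prob_pOut_clusterEvent_of_mem p ends h31.symm (Finset.mem_filter.1 hW).2,
      zero_mul, mul_zero]
  show ∑ W, F W = ∑ W, G W
  rw [← hL, ← hR, hL0, hR0, add_zero, zero_add]
  refine Finset.sum_bij' (fun W _ => W.erase a₃) (fun W' _ => insert a₃ W') ?_ ?_ ?_ ?_ ?_
  · intro W hW
    simp only [Finset.mem_filter, Finset.mem_univ, true_and, Finset.mem_erase, ne_eq,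
      not_true_eq_false, false_and, not_false_eq_true]
  · intro W' hW'
    simp only [Finset.mem_filter, Finset.mem_univ, true_and, Finset.mem_insert, true_or]
  · intro W hW
    exact Finset.insert_erase (Finset.mem_filter.1 hW).2
  · intro W' hW'
    exact Finset.erase_insert (Finset.mem_filter.1 hW').2
  · intro W hW
    have h3W : a₃ ∈ W := (Finset.mem_filter.1 hW).2
    simp only [hF, hG, if_pos h3W, fac]
    have : W = insert a₃ (W.erase a₃) := (Finset.insert_erase h3W).symm
    conv_lhs => rw [this]
    rw [StarO.termW_insert_a3 p ends (W.erase a₃) h31 h32 h3o h3b, Finset.erase_insert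
      (Finset.notMem_erase a₃ W)]
    ring

omit [LinearOrder R] [IsStrictOrderedRing R] in
/-- **The mean field at the four-coin hub star**, row sums by outcome: the all-closed term, the
light / heavy row sums, and the eight `b`-open outcomes as plain connection events. -/
theorem Xhat_star_h (hf₁ : ends f₁ = s(a₃, a₁)) (hf₂ : ends f₂ = s(a₃, a₂))
    (hf₃ : ends f₃ = s(a₃, o)) (hf₄ : ends f₄ = s(a₃, b))
    (hstar : ∀ e, a₃ ∈ ends e → e = f₁ ∨ e = f₂ ∨ e = f₃ ∨ e = f₄)
    (h31 : a₃ ≠ a₁) (h32 : a₃ ≠ a₂) (h3o : a₃ ≠ o) (h3b : a₃ ≠ b) (h12 : f₁ ≠ f₂) (h13 : f₁ ≠ f₃)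
    (h14 : f₁ ≠ f₄) (h23 : f₂ ≠ f₃) (h24 : f₂ ≠ f₄) (h34 : f₃ ≠ f₄) :
    Xhat p ends o a₁ a₂ a₃ b =
      (1 - p f₁) * (1 - p f₂) * (1 - p f₃) * (1 - p f₄) * termW p ends o a₁ a₂ b {a₃} +
        p f₁ * (1 - p f₂) * (1 - p f₃) * (1 - p f₄) * lightSum ends (pOut p ends a₃) o a₁ a₂ b +
        (1 - p f₁) * p f₂ * (1 - p f₃) * (1 - p f₄) * heavySum ends (pOut p ends a₃) o a₁ a₂ b +
        ∑ b₁ : Bool, ∑ b₂ : Bool, ∑ b₃ : Bool,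
          (prob p (outc₄ f₁ f₂ f₃ f₄ b₁ b₂ b₃ true ∩ connEvent ends a₃ a₁ ∩
              (connEvent ends a₃ a₂)ᶜ ∩ connEvent ends a₂ o) +
            prob p (outc₄ f₁ f₂ f₃ f₄ b₁ b₂ b₃ true ∩ connEvent ends a₃ a₂ ∩
              (connEvent ends a₃ a₁)ᶜ ∩ connEvent ends a₁ o)) := by
  rw [Xhat_eq_sum]
  have hsplit : ∀ W : Finset V, prob p (clusterEvent ends a₃ (↑W : Set V)) * termW p ends o a₁ a₂ b W =
      ∑ b₁ : Bool, ∑ b₂ : Bool, ∑ b₃ : Bool, ∑ b₄ : Bool,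
        prob p (clusterEvent ends a₃ (↑W : Set V) ∩ outc₄ f₁ f₂ f₃ f₄ b₁ b₂ b₃ b₄) *
          termW p ends o a₁ a₂ b W := by
    intro W
    rw [prob_eq_sum_outc₄ p f₁ f₂ f₃ f₄ (clusterEvent ends a₃ (↑W : Set V))]
    simp only [Finset.sum_mul]
  simp only [hsplit, Fintype.sum_bool]
  simp only [Finset.sum_add_distrib]
  rw [sum_rows_of_outc_b₄ p ends hf₁ hf₂ hf₃ hf₄ true true true,
    sum_rows_of_outc_b₄ p ends hf₁ hf₂ hf₃ hf₄ true true false,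
    sum_rows_of_outc_b₄ p ends hf₁ hf₂ hf₃ hf₄ true false true,
    sum_rows_of_outc_b₄ p ends hf₁ hf₂ hf₃ hf₄ true false false,
    sum_rows_of_outc_b₄ p ends hf₁ hf₂ hf₃ hf₄ false true true,
    sum_rows_of_outc_b₄ p ends hf₁ hf₂ hf₃ hf₄ false true false,
    sum_rows_of_outc_b₄ p ends hf₁ hf₂ hf₃ hf₄ false false true,
    sum_rows_of_outc_b₄ p ends hf₁ hf₂ hf₃ hf₄ false false false,
    sum_f3_rows_zero₄ p ends hf₃ true true false, sum_f3_rows_zero₄ p ends hf₃ true false false,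
    sum_f3_rows_zero₄ p ends hf₃ false true false, sum_f3_rows_zero₄ p ends hf₃ false false false,
    sum_f12_rows_zero₄ p ends hf₁ hf₂ false false,
    sum_f2_rows₄ p ends hf₁ hf₂ hf₃ hf₄ hstar h31 h32 h3o h3b h12 h13 h14 h23 h24 h34,
    sum_f1_rows₄ p ends hf₁ hf₂ hf₃ hf₄ hstar h31 h32 h3o h3b h12 h13 h14 h23 h24 h34,
    sum_cccc_rows p ends hf₁ hf₂ hf₃ hf₄ hstar h31 h32 h3o h3b h12 h13 h14 h23 h24 h34]
  ring

end Xhat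

end StarH

end Summit.Ventures.PercRepro2
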